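import Summits.QuantumFields.QCD.Theorems.QuarksAsStableActionStableActionBridgeTransferPositivity

/-!
# Order structure of the min–max levels of the QCD transfer operator
(crux `QuarksAsStableAction.StableActionBridge`, item stmt-QuantumFields-9737, line `Sketch`;
registered sub-goal `qcdTransferLevel_antitone`)

`Literature/MathematicalPhysics/QuantumFieldTheory/QCDTransferMatrix.lean` defines the min–max levels
of Lüscher's transfer operator `T̂` of lattice QCD with `r = 1` Wilson quarks on the gauge-invariant
subspace as real numbers
`qcdTransferLevel Nf S β mq n = inf_{Φ₁,…,Φₙ ∈ core} sup {R(Ψ) : Ψ ∈ core, 𝔫(Ψ,Ψ) ≠ 0, 𝔫(Φᵢ,Ψ) = 0 ∀ i}`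
(`R = transferRayleigh`, `𝔫 = fermionWeightForm`, `core = transferCore` = continuous gauge-invariant
wave functions), with the conventions `sSup ∅ = sInf ∅ = 0` of `ℝ`.  This file proves the elementary
ORDER content of the min–max principle for these numbers, for `β ≥ 0` and all `m_f > −1`:

* every level is `≥ 0` (`TransferLevelOrder.qcdTransferLevel_nonneg`): the Rayleigh quotient is
  non-negative on continuous waves (`transferRayleigh_nonneg`, i.e. `T̂ ≥ 0`), so every constrained
  supremum and hence their infimum is `≥ 0`;
* the levels are antitone in `n`, `λ₀ ≥ λ₁ ≥ λ₂ ≥ ⋯` (`qcdTransferLevel_antitone`): extending a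
  constraint family `Φ : Fin n → core` by the vacuum wave (`Fin.snoc Φ (U ↦ |0⟩)`, in the core by
  `vacuum_mem_transferCore`) only shrinks the constrained set, so the `(n+1)`-st level is bounded by
  every competitor of the `n`-th; the suprema are finite because `T̂` is bounded
  (`transferRayleigh_le`).

Reusable helpers (namespace `TransferLevelOrder`): `sSup_transferRayleigh_image_nonneg`,
`bddAbove_transferRayleigh_image`, `qcdTransferLevel_sSup_nonneg`, `bddBelow_qcdTransferLevel_set`,
`qcdTransferLevel_set_nonempty`, `qcdTransferLevel_nonneg`, `qcdTransferLevel_le_sSup`,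
`sSup_transferRayleigh_constraint_mono`, `qcdTransferLevel_succ_le`.

References: M. Reed, B. Simon, *Methods of Modern Mathematical Physics IV*, Thm XIII.1 (min–max
principle) [ReedSimonIV1978]; M. Lüscher, Commun. Math. Phys. 54 (1977) 283 [Luscher1977, pp. 283–292].
Pure theorem file (no definitions).
-/

namespace Summit.QuantumFields.QCD.Cruxes.StableActionBridge.Sketch

open scoped ComplexOrder
open MeasureTheory Matrix Literature.MathematicalPhysics.QuantumFieldTheory
  Literature.MathematicalPhysics.QuantumLattice

namespace TransferLevelOrder

variable {Nf S : ℕ} [NeZero S] {β : ℝ} {mq : Fin Nf → ℝ}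

/-- The supremum of the Rayleigh quotient over any set of continuous waves is `≥ 0` (all its values
are `≥ 0` by `transferRayleigh_nonneg`; `sSup ∅ = 0` and an unbounded `sSup` is `0` in `ℝ`). [folklore] -/
theorem sSup_transferRayleigh_image_nonneg (hβ : 0 ≤ β) (hm : ∀ f, -1 < mq f)
    {C : Set (SliceWave Nf S)} (hC : ∀ Ψ ∈ C, Continuous Ψ) :
    0 ≤ sSup (transferRayleigh β mq '' C) := by
  refine Real.sSup_nonneg ?_
  rintro _ ⟨Ψ, hΨ, rfl⟩
  exact transferRayleigh_nonneg Nf S β mq hβ hm Ψ (hC Ψ hΨ)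

/-- The Rayleigh quotient is bounded above on any set of continuous waves (`T̂` is a bounded
operator: `transferRayleigh_le`). [folklore] -/
theorem bddAbove_transferRayleigh_image (hβ : 0 ≤ β) (hm : ∀ f, -1 < mq f)
    {C : Set (SliceWave Nf S)} (hC : ∀ Ψ ∈ C, Continuous Ψ) :
    BddAbove (transferRayleigh β mq '' C) := by
  obtain ⟨Λ, -, hΛ⟩ := transferRayleigh_le Nf S β mq hβ hm
  refine ⟨Λ, ?_⟩
  rintro _ ⟨Ψ, hΨ, rfl⟩
  exact hΛ Ψ (hC Ψ hΨ)

/-- Every wave in the constrained core `{Ψ ∈ core, 𝔫(Ψ,Ψ) ≠ 0, 𝔫(Φᵢ,Ψ) = 0}` of the min–max level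
is continuous (the core consists of continuous gauge-invariant waves). [folklore] -/
theorem continuous_of_mem_constraint {n : ℕ} (Φ : Fin n → SliceWave Nf S) :
    ∀ Ψ ∈ {Ψ : SliceWave Nf S | Ψ ∈ transferCore Nf S ∧ fermionWeightForm mq Ψ Ψ ≠ 0 ∧
        ∀ i, fermionWeightForm mq (Φ i) Ψ = 0}, Continuous Ψ :=
  fun _ hΨ => hΨ.1.1

/-- The constrained supremum `F_n(Φ) = sup {R(Ψ) : Ψ ∈ core, 𝔫(Ψ,Ψ) ≠ 0, 𝔫(Φᵢ,Ψ) = 0}` entering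
`qcdTransferLevel … n` is `≥ 0` for every constraint family `Φ`. [folklore] -/
theorem qcdTransferLevel_sSup_nonneg (hβ : 0 ≤ β) (hm : ∀ f, -1 < mq f) {n : ℕ}
    (Φ : Fin n → SliceWave Nf S) :
    0 ≤ sSup (transferRayleigh β mq '' {Ψ | Ψ ∈ transferCore Nf S ∧ fermionWeightForm mq Ψ Ψ ≠ 0 ∧
        ∀ i, fermionWeightForm mq (Φ i) Ψ = 0}) :=
  sSup_transferRayleigh_image_nonneg hβ hm (continuous_of_mem_constraint Φ)

/-- The set of constrained suprema `{F_n(Φ) : Φ : Fin n → core}` whose infimum is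
`qcdTransferLevel … n` is bounded below by `0`. [folklore] -/
theorem bddBelow_qcdTransferLevel_set (hβ : 0 ≤ β) (hm : ∀ f, -1 < mq f) (n : ℕ) :
    BddBelow ((fun Φ : Fin n → SliceWave Nf S =>
      sSup (transferRayleigh β mq '' {Ψ | Ψ ∈ transferCore Nf S ∧ fermionWeightForm mq Ψ Ψ ≠ 0 ∧
        ∀ i, fermionWeightForm mq (Φ i) Ψ = 0})) '' {Φ | ∀ i, Φ i ∈ transferCore Nf S}) := by
  refine ⟨0, ?_⟩
  rintro _ ⟨Φ, -, rfl⟩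
  exact qcdTransferLevel_sSup_nonneg hβ hm Φ

/-- The set of constrained suprema `{F_n(Φ) : Φ : Fin n → core}` is nonempty: the constant family of
vacuum waves is an admissible constraint family (`vacuum_mem_transferCore`). [folklore] -/
theorem qcdTransferLevel_set_nonempty (β : ℝ) (mq : Fin Nf → ℝ) (n : ℕ) :
    ((fun Φ : Fin n → SliceWave Nf S =>
      sSup (transferRayleigh β mq '' {Ψ | Ψ ∈ transferCore Nf S ∧ fermionWeightForm mq Ψ Ψ ≠ 0 ∧
        ∀ i, fermionWeightForm mq (Φ i) Ψ = 0})) '' {Φ | ∀ i, Φ i ∈ transferCore Nf S}).Nonempty :=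
  ⟨_, fun (_ : Fin n) (_ : GaugeConfig 3 S (Matrix.specialUnitaryGroup (Fin 3) ℂ)) =>
      (vacuum : Fock (SliceFermiIdx Nf S)), fun _ => vacuum_mem_transferCore, rfl⟩

/-- **Every min–max level is non-negative**, `0 ≤ λₙ` (`T̂ ≥ 0`): each constrained supremum is
`≥ 0`, hence so is their infimum (`Real.sInf_nonneg`). [folklore] -/
theorem qcdTransferLevel_nonneg (hβ : 0 ≤ β) (hm : ∀ f, -1 < mq f) (n : ℕ) :
    0 ≤ qcdTransferLevel Nf S β mq n := by
  unfold qcdTransferLevel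
  refine Real.sInf_nonneg ?_
  rintro _ ⟨Φ, -, rfl⟩
  exact qcdTransferLevel_sSup_nonneg hβ hm Φ

/-- The level is below every competitor: `λₙ ≤ F_n(Φ)` for every constraint family `Φ` in the core
(`csInf_le`, the set of competitors being bounded below by `0`). [folklore] -/
theorem qcdTransferLevel_le_sSup (hβ : 0 ≤ β) (hm : ∀ f, -1 < mq f) {n : ℕ}
    (Φ : Fin n → SliceWave Nf S) (hΦ : ∀ i, Φ i ∈ transferCore Nf S) :
    qcdTransferLevel Nf S β mq n ≤
      sSup (transferRayleigh β mq '' {Ψ | Ψ ∈ transferCore Nf S ∧ fermionWeightForm mq Ψ Ψ ≠ 0 ∧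
        ∀ i, fermionWeightForm mq (Φ i) Ψ = 0}) := by
  unfold qcdTransferLevel
  exact csInf_le (bddBelow_qcdTransferLevel_set hβ hm n) ⟨Φ, hΦ, rfl⟩

/-- **More constraints, smaller supremum**: if every constraint wave `Φ i` occurs in the family `Φ'`,
then `F(Φ') ≤ F(Φ)` — the constrained set of `Φ'` is contained in that of `Φ` (and if it has empty
image, `sSup ∅ = 0 ≤ F(Φ)`). [folklore] -/
theorem sSup_transferRayleigh_constraint_mono (hβ : 0 ≤ β) (hm : ∀ f, -1 < mq f) {n n' : ℕ}
    (Φ : Fin n → SliceWave Nf S) (Φ' : Fin n' → SliceWave Nf S) (h : ∀ i, ∃ j, Φ' j = Φ i) :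
    sSup (transferRayleigh β mq '' {Ψ | Ψ ∈ transferCore Nf S ∧ fermionWeightForm mq Ψ Ψ ≠ 0 ∧
        ∀ j, fermionWeightForm mq (Φ' j) Ψ = 0}) ≤
      sSup (transferRayleigh β mq '' {Ψ | Ψ ∈ transferCore Nf S ∧ fermionWeightForm mq Ψ Ψ ≠ 0 ∧
        ∀ i, fermionWeightForm mq (Φ i) Ψ = 0}) := by
  have hsub : {Ψ : SliceWave Nf S | Ψ ∈ transferCore Nf S ∧ fermionWeightForm mq Ψ Ψ ≠ 0 ∧
        ∀ j, fermionWeightForm mq (Φ' j) Ψ = 0} ⊆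
      {Ψ | Ψ ∈ transferCore Nf S ∧ fermionWeightForm mq Ψ Ψ ≠ 0 ∧
        ∀ i, fermionWeightForm mq (Φ i) Ψ = 0} := by
    intro Ψ hΨ
    refine ⟨hΨ.1, hΨ.2.1, fun i => ?_⟩
    obtain ⟨j, hj⟩ := h i
    rw [← hj]
    exact hΨ.2.2 j
  rcases (transferRayleigh β mq '' {Ψ : SliceWave Nf S | Ψ ∈ transferCore Nf S ∧
      fermionWeightForm mq Ψ Ψ ≠ 0 ∧ ∀ j, fermionWeightForm mq (Φ' j) Ψ = 0}).eq_empty_or_nonempty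
    with he | hne
  · rw [he, Real.sSup_empty]
    exact qcdTransferLevel_sSup_nonneg hβ hm Φ
  · exact csSup_le_csSup (bddAbove_transferRayleigh_image hβ hm (continuous_of_mem_constraint Φ)) hne
      (Set.image_mono hsub)

/-- Extending a constraint family in the core by the vacuum wave stays in the core. [folklore] -/
theorem snoc_vacuum_mem_transferCore {n : ℕ} (Φ : Fin n → SliceWave Nf S)
    (hΦ : ∀ i, Φ i ∈ transferCore Nf S) (i : Fin (n + 1)) :
    (Fin.snoc Φ (fun _ => (vacuum : Fock (SliceFermiIdx Nf S))) : Fin (n + 1) → SliceWave Nf S) i ∈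
      transferCore Nf S := by
  refine Fin.lastCases ?_ (fun i => ?_) i
  · rw [Fin.snoc_last]
    exact vacuum_mem_transferCore
  · rw [Fin.snoc_castSucc]
    exact hΦ i

/-- **One min–max step**: `λₙ₊₁ ≤ λₙ`.  For every competitor `Φ : Fin n → core` of level `n`, the
extended family `Fin.snoc Φ (U ↦ |0⟩)` competes at level `n + 1` with a smaller constrained
supremum, so `λₙ₊₁ ≤ F_{n+1}(snoc Φ |0⟩) ≤ F_n(Φ)`; take the infimum over `Φ` (`le_csInf`).
[cite: ReedSimonIV1978, Thm XIII.1] -/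
theorem qcdTransferLevel_succ_le (hβ : 0 ≤ β) (hm : ∀ f, -1 < mq f) (n : ℕ) :
    qcdTransferLevel Nf S β mq (n + 1) ≤ qcdTransferLevel Nf S β mq n := by
  conv_rhs => unfold qcdTransferLevel
  refine le_csInf (qcdTransferLevel_set_nonempty β mq n) ?_
  rintro _ ⟨Φ, hΦ, rfl⟩
  refine (qcdTransferLevel_le_sSup hβ hm
    (Fin.snoc Φ (fun _ => (vacuum : Fock (SliceFermiIdx Nf S))) : Fin (n + 1) → SliceWave Nf S)
    (snoc_vacuum_mem_transferCore Φ hΦ)).trans ?_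
  exact sSup_transferRayleigh_constraint_mono hβ hm Φ _ fun i => ⟨Fin.castSucc i, Fin.snoc_castSucc ..⟩

end TransferLevelOrder

/-- **The min–max levels of the QCD transfer operator are antitone and non-negative**:
`λ₀ ≥ λ₁ ≥ λ₂ ≥ ⋯ ≥ 0` for `β ≥ 0` and all bare quark masses `m_f > −1` — the order content of the
min–max principle for the positive bounded operator `T̂` (adding the vacuum wave as an extra
constraint shrinks the constrained supremum; all Rayleigh quotients are `≥ 0`).  Registered sub-goal
of crux stmt-QuantumFields-9737, line `Sketch`. [cite: ReedSimonIV1978, Thm XIII.1] -/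
theorem qcdTransferLevel_antitone : ∀ (Nf S : ℕ) [NeZero S] (β : ℝ) (mq : Fin Nf → ℝ), 0 ≤ β → (∀ f, -1 < mq f) → Antitone (qcdTransferLevel Nf S β mq) ∧ ∀ n, 0 ≤ qcdTransferLevel Nf S β mq n :=
  fun _ _ _ _ _ hβ hm =>
    ⟨antitone_nat_of_succ_le fun n => TransferLevelOrder.qcdTransferLevel_succ_le hβ hm n,
      TransferLevelOrder.qcdTransferLevel_nonneg hβ hm⟩

end Summit.QuantumFields.QCD.Cruxes.StableActionBridge.Sketch
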